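import Summits.QuantumFields.YangMills.Theses.DyadicChessboard
import Literature.MathematicalPhysics.QuantumFieldTheory.CentreDominatedStringTension
import HarnessLib

/-!
# Crux `DyadicChessboard.OddDyadicCoincidence` (stmt-QuantumFields-23369), line «birth» (K2 skeleton, ym-idea-11 g9/g14,
# sha 264cbd40): stub `stub_commonClusterPoint : CoincidenceFromMergingC` — PROVED

`MergingC → OddDyadicCoincidence`: compactness + ε/2.  Along the odd tori of sides `2·2^{k+1}+1` the torus Wilson states have a
convergent subsequence `k = φ(j)` with limit `μ` (tree: `CentreDominatedStringTension.exists_isInfiniteVolumeLimitAlong_comp`,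
compactness of the probability measures on the compact configuration space), so `μ ∈ oddTorusLimitPoints r β` with
`S j = 2^{φ j + 1}`; along the dyadic sides `2^{φ j + 2}` the expectations of a bounded continuous cylinder observable differ from
the odd ones by the merging difference, which tends to `0` by `MergingC` (composed with `φ`), so `μ` is also an infinite-volume
limit along the dyadic tori `2^{S' j}`, `S' j = φ j + 2`.  The two `abbrev`s are copied VERBATIM from the registered skeleton.

HONEST LABEL: one registered stub (the M-sized compactness half) of an OPEN crux; `MergingC` (`stub_dyadicOddMerging`, L,
content) stays open; no crux, leaf, rung or summit statement is proved; the Yang–Mills mass gap is NOT proved.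
References: E. Seiler, LNP 159 (1982) Ch. 2 [Seiler1982]; S. Chatterjee, arXiv:1803.01950 §2 [ChatterjeeYMProb2019].
-/

set_option autoImplicit false

noncomputable section

open MeasureTheory Filter Topology
open Literature.MathematicalPhysics.QuantumFieldTheory Literature.MathematicalPhysics.QuantumLattice

namespace Summit.QuantumFields.YangMills.Cruxes.OddDyadicCoincidence.Birth

/-- **K2a «MergingC» (content, L)**: boundary-condition merging of bounded continuous cylinder expectations on the consecutive
tori of sides `2^{k+2}` (dyadic) and `2^{k+2}+1` (odd), for `G ≅ SU(2)`, every lattice representation and all large `β`.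
(Registered skeleton text, verbatim; an OPEN statement, not a literature fact.) -/
abbrev MergingC : Prop :=
  ∀ (G : Type) [Group G] [TopologicalSpace G] [IsTopologicalGroup G] [CompactSpace G],
    IsCompactSimpleLieGroup G → Nonempty (G ≃ₜ* Matrix.specialUnitaryGroup (Fin 2) ℂ) →
    letI : MeasurableSpace G := borel G
    haveI : BorelSpace G := ⟨rfl⟩
    ∀ r : LatticeRep G, ∃ β₆ : ℝ, ∀ β : ℝ, β₆ ≤ β →
      ∀ (F : LGConfig 4 G → ℝ) (S : Finset (Literature.MathematicalPhysics.QuantumLattice.ZdEdge 4)), IsCylinder F S → Continuous F → (∃ C, ∀ U, |F U| ≤ C) →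
        Tendsto (fun k : ℕ =>
            wilsonExpectation (L := 2 * 2 ^ (k + 1) + 1) r.ρ β (toTorusObservable (2 * 2 ^ (k + 1) + 1) F) -
              wilsonExpectation (L := 2 ^ (k + 2) - 1 + 1) r.ρ β (toTorusObservable (2 ^ (k + 2) - 1 + 1) F))
          atTop (𝓝 0)

/-- **K2b «CoincidenceFromMergingC» (M, compactness + ε/2)**: merging ⟹ a common odd/dyadic infinite-volume limit point.
(Registered skeleton text, verbatim.) -/
abbrev CoincidenceFromMergingC : Prop :=
  MergingC → Summit.QuantumFields.YangMills.Theses.DyadicChessboard.OddDyadicCoincidence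

/-- **Stub K2b `stub_commonClusterPoint` (registered name and signature), PROVED**: a subsequential infinite-volume limit
along the odd tori `2·2^{k+1}+1` (compactness) is, under `MergingC`, also a limit along the dyadic tori `2^{k+2}` (ε/2).
[cite: Seiler1982, Ch. 2] -/
theorem stub_commonClusterPoint : CoincidenceFromMergingC := by
  intro hM G _ _ _ _ hG hiso
  letI : MeasurableSpace G := borel G
  haveI : BorelSpace G := ⟨rfl⟩
  intro r
  obtain ⟨β₆, hβ₆⟩ := hM G hG hiso r
  refine ⟨β₆, fun β hβ => ?_⟩
  haveI : T2Space G := (r.continuous.isClosedEmbedding r.injective).isEmbedding.t2Space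
  haveI : SecondCountableTopology G :=
    (r.continuous.isClosedEmbedding r.injective).isEmbedding.secondCountableTopology
  have hLs : StrictMono fun k : ℕ => 2 * 2 ^ (k + 1) := fun a b hab => by
    dsimp only
    have := Nat.pow_lt_pow_right (by norm_num : 1 < 2) (Nat.add_lt_add_right hab 1)
    omega
  obtain ⟨μ, φ, hφ, hlim, -⟩ :=
    CentreDominatedStringTension.exists_isInfiniteVolumeLimitAlong_comp (d := 4) (ρ' := r.ρ) r.continuous β hLs
  have hodd : IsInfiniteVolumeLimitAlong (d := 4) r.ρ β (fun k => 2 * 2 ^ (φ k + 1)) μ := hlim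
  refine ⟨μ, ⟨fun k => 2 ^ (φ k + 1), fun a b hab => ?_, hodd⟩, fun k => φ k + 2, fun a b hab => ?_, ?_⟩
  · exact Nat.pow_lt_pow_right (by norm_num : 1 < 2) (Nat.add_lt_add_right (hφ hab) 1)
  · exact Nat.add_lt_add_right (hφ hab) 2
  · refine ⟨hodd.1, fun F S hFS hFc hFb => ?_⟩
    have h1 := hodd.2 F S hFS hFc hFb
    have h2 := (hβ₆ β hβ F S hFS hFc hFb).comp hφ.tendsto_atTop
    have h3 := h1.sub h2
    rw [sub_zero] at h3
    refine h3.congr fun k => ?_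
    simp only [Function.comp_apply, sub_sub_cancel]

end Summit.QuantumFields.YangMills.Cruxes.OddDyadicCoincidence.Birth

end
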